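import Mathlib.Combinatorics.SimpleGraph.Walk.Counting
import Mathlib.Combinatorics.SimpleGraph.Paths
import Mathlib.Combinatorics.SimpleGraph.DeleteEdges
import Literature.Probability.RandomPlanarGeometry.SelfAvoidingWalk
import HarnessLib
import Summits.CriticalPhenomena.SAWScalingLimit.Theorems.SAWTotalPositivityBoundaryTP2Defs

/-!
# Crux `BoundaryTP2` (stmt-CriticalPhenomena-7115), line `Sketch`: symmetries of the path kernel and of the
TP₂ hypotheses

Everything proved (namespace `…Theorems.BoundaryTP2`): reversal `pathKernel_comm`, the trivial values
`pathKernel_self = 1` / `pathKernel = 0` off the reachability class, monotonicity in the graph, and the action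
of the Klein four-group of relabellings `(12)(34)`, `(13)(24)`, `(14)(23)` on `Interlaced` / `DisjointPaths` and on
the TP₂ inequality — so that an argument about one marked vertex (a "corner") applies to any of the four.
-/

noncomputable section

namespace Summit.CriticalPhenomena.SAWScalingLimit.Theorems.BoundaryTP2

open Literature.Probability.LatticeModels Literature.Probability.RandomPlanarGeometry
open scoped ENNReal

variable {V : Type*} {H : SimpleGraph V}

/-! ## Reversal -/

/-- Reversal of self-avoiding paths, as an equivalence `H.Path a b ≃ H.Path b a`. [folklore] -/
def pathReverseEquiv (H : SimpleGraph V) (a b : V) : H.Path a b ≃ H.Path b a where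
  toFun γ := ⟨γ.1.reverse, γ.2.reverse⟩
  invFun γ := ⟨γ.1.reverse, γ.2.reverse⟩
  left_inv γ := by ext; simp
  right_inv γ := by ext; simp

/-- The path kernel is symmetric: `Z(a,b) = Z(b,a)`. [folklore] -/
theorem pathKernel_comm (H : SimpleGraph V) (x : ℝ) (a b : V) :
    pathKernel H x a b = pathKernel H x b a := by
  rw [pathKernel, pathKernel, ← Equiv.tsum_eq (pathReverseEquiv H b a)]
  refine tsum_congr fun γ => ?_
  simp [pathReverseEquiv, SimpleGraph.Walk.length_reverse]

/-- Reversal for kernels restricted by a condition on the vertex set of the path. [folklore] -/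
theorem pathKernelOn_comm_of_support (H : SimpleGraph V) (x : ℝ) (a b : V) (P : Set V → Prop) :
    pathKernelOn H x a b {γ | P {v | v ∈ γ.1.support}} =
      pathKernelOn H x b a {γ | P {v | v ∈ γ.1.support}} := by
  classical
  rw [pathKernelOn, pathKernelOn, ← Equiv.tsum_eq (pathReverseEquiv H b a)]
  refine tsum_congr fun γ => ?_
  have hset : {v | v ∈ ((pathReverseEquiv H b a) γ).1.support} = {v | v ∈ γ.1.support} := by
    ext v; simp [pathReverseEquiv, SimpleGraph.Walk.support_reverse]
  simp only [Set.indicator_apply, Set.mem_setOf_eq]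
  by_cases h : P {v | v ∈ γ.1.support}
  · have h' : P {v | v ∈ ((pathReverseEquiv H b a) γ).1.support} := by rw [hset]; exact h
    rw [if_pos h', if_pos h]
    simp [pathReverseEquiv, SimpleGraph.Walk.length_reverse]
  · have h' : ¬ P {v | v ∈ ((pathReverseEquiv H b a) γ).1.support} := by rw [hset]; exact h
    rw [if_neg h', if_neg h]

/-- Reversal for the kernel of paths avoiding a vertex. [folklore] -/
theorem pathKernelOn_avoid_comm (H : SimpleGraph V) (x : ℝ) (a b c : V) :
    pathKernelOn H x a b {γ | c ∉ γ.1.support} = pathKernelOn H x b a {γ | c ∉ γ.1.support} :=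
  pathKernelOn_comm_of_support H x a b (fun S => c ∉ S)

/-- Reversal for the kernel of paths through a vertex. [folklore] -/
theorem pathKernelOn_visit_comm (H : SimpleGraph V) (x : ℝ) (a b c : V) :
    pathKernelOn H x a b {γ | c ∈ γ.1.support} = pathKernelOn H x b a {γ | c ∈ γ.1.support} :=
  pathKernelOn_comm_of_support H x a b (fun S => c ∈ S)

/-! ## Trivial values and monotonicity -/

/-- `Z(a,a) = 1`: the only self-avoiding path from a vertex to itself is the trivial one. [folklore] -/
theorem pathKernel_self (H : SimpleGraph V) (x : ℝ) (a : V) : pathKernel H x a a = 1 := by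
  have huniq : ∀ γ : H.Path a a, γ = ⟨SimpleGraph.Walk.nil, SimpleGraph.Walk.IsPath.nil⟩ := by
    rintro ⟨p, hp⟩
    ext
    exact SimpleGraph.Walk.eq_nil_iff_nil.2 (SimpleGraph.Walk.isPath_iff_nil.1 hp)
  rw [pathKernel, tsum_eq_single (⟨SimpleGraph.Walk.nil, SimpleGraph.Walk.IsPath.nil⟩ : H.Path a a)]
  · simp
  · intro γ hγ
    exact absurd (huniq γ) hγ

/-- Off the reachability class the kernel vanishes. [folklore] -/
theorem pathKernel_eq_zero_of_not_reachable (H : SimpleGraph V) (x : ℝ) {a b : V}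
    (h : ¬ H.Reachable a b) : pathKernel H x a b = 0 := by
  rw [pathKernel, ENNReal.tsum_eq_zero]
  intro γ
  exact absurd ⟨γ.1⟩ h

/-- The kernel is monotone in the graph (for `x ≥ 0` trivially; in general because `ofReal` of each term is
carried along an injection of paths). [folklore] -/
theorem pathKernel_mono {H H' : SimpleGraph V} (hle : H ≤ H') (x : ℝ) (a b : V) :
    pathKernel H x a b ≤ pathKernel H' x a b := by
  classical
  let f : H.Path a b → H'.Path a b := fun γ => ⟨γ.1.mapLe hle, γ.2.mapLe hle⟩
  have hf : Function.Injective f := by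
    intro γ γ' h
    have h1 : (γ.1.mapLe hle) = (γ'.1.mapLe hle) := congrArg Subtype.val h
    exact Subtype.ext (SimpleGraph.Walk.map_injective_of_injective
      (f := SimpleGraph.Hom.ofLE hle) Function.injective_id a b h1)
  calc pathKernel H x a b
      = ∑' γ : H.Path a b, ENNReal.ofReal (x ^ (f γ).1.length) := by
        refine tsum_congr fun γ => ?_
        rw [show (f γ).1.length = γ.1.length from SimpleGraph.Walk.length_map (SimpleGraph.Hom.ofLE hle) γ.1]
    _ ≤ ∑' γ' : H'.Path a b, ENNReal.ofReal (x ^ γ'.1.length) :=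
        ENNReal.tsum_comp_le_tsum_of_injective hf (fun γ' : H'.Path a b => ENNReal.ofReal (x ^ γ'.1.length))
    _ = pathKernel H' x a b := rfl

/-! ## Relabelling symmetries of the hypotheses -/

/-- `Interlaced` is symmetric under exchanging the two pairs: `(12)(34)`. [folklore] -/
theorem Interlaced.swap {p₁ p₂ p₃ p₄ : V} (h : Interlaced H p₁ p₂ p₃ p₄) : Interlaced H p₂ p₁ p₄ p₃ := by
  intro P Q
  obtain ⟨v, hvQ, hvP⟩ := h Q P
  exact ⟨v, hvP, hvQ⟩

/-- `Interlaced` is symmetric under reversing the first pair: `p₁ ↔ p₃`. [folklore] -/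
theorem Interlaced.reverse_left {p₁ p₂ p₃ p₄ : V} (h : Interlaced H p₁ p₂ p₃ p₄) :
    Interlaced H p₃ p₂ p₁ p₄ := by
  intro P Q
  obtain ⟨v, hvP, hvQ⟩ := h ⟨P.1.reverse, P.2.reverse⟩ Q
  exact ⟨v, by simpa [SimpleGraph.Walk.support_reverse] using hvP, hvQ⟩

/-- `Interlaced` is symmetric under reversing the second pair: `p₂ ↔ p₄`. [folklore] -/
theorem Interlaced.reverse_right {p₁ p₂ p₃ p₄ : V} (h : Interlaced H p₁ p₂ p₃ p₄) :
    Interlaced H p₁ p₄ p₃ p₂ := by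
  intro P Q
  obtain ⟨v, hvP, hvQ⟩ := h P ⟨Q.1.reverse, Q.2.reverse⟩
  exact ⟨v, hvP, by simpa [SimpleGraph.Walk.support_reverse] using hvQ⟩

/-- The relabelling `(13)(24)` (both pairs reversed … composed with the swap it generates the Klein group
used below). [folklore] -/
theorem Interlaced.rotate {p₁ p₂ p₃ p₄ : V} (h : Interlaced H p₁ p₂ p₃ p₄) : Interlaced H p₃ p₄ p₁ p₂ :=
  h.reverse_left.reverse_right

/-- `DisjointPaths` is symmetric under exchanging the two pairs. [folklore] -/
theorem DisjointPaths.swap {a b c d : V} (h : DisjointPaths H a b c d) : DisjointPaths H c d a b := by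
  obtain ⟨P, Q, hPQ⟩ := h
  exact ⟨Q, P, hPQ.symm⟩

/-- `DisjointPaths` is symmetric under reversing the first path. [folklore] -/
theorem DisjointPaths.reverse_left {a b c d : V} (h : DisjointPaths H a b c d) : DisjointPaths H b a c d := by
  obtain ⟨P, Q, hPQ⟩ := h
  refine ⟨⟨P.1.reverse, P.2.reverse⟩, Q, ?_⟩
  simpa [SimpleGraph.Walk.support_reverse, List.disjoint_reverse_left] using hPQ

/-- `DisjointPaths` is symmetric under reversing the second path. [folklore] -/
theorem DisjointPaths.reverse_right {a b c d : V} (h : DisjointPaths H a b c d) : DisjointPaths H a b d c :=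
  h.swap.reverse_left.swap

/-! ## The Klein four-group acts on TP₂ instances -/

/-- The TP₂ inequality for a quadruple, as a predicate (local abbreviation, not a definition of the tree). -/
private theorem tp2_iff_swap12_34 (H : SimpleGraph V) (x : ℝ) (p₁ p₂ p₃ p₄ : V) :
    (pathKernel H x p₁ p₃ * pathKernel H x p₂ p₄ ≤ pathKernel H x p₁ p₂ * pathKernel H x p₃ p₄) ↔
    (pathKernel H x p₂ p₄ * pathKernel H x p₁ p₃ ≤ pathKernel H x p₂ p₁ * pathKernel H x p₄ p₃) := by
  rw [mul_comm (pathKernel H x p₂ p₄), pathKernel_comm H x p₂ p₁, pathKernel_comm H x p₄ p₃]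

/-- Relabelling `(12)(34)`: the TP₂ instance `(p₂,p₁,p₄,p₃)` is the instance `(p₁,p₂,p₃,p₄)`. [folklore] -/
theorem tp2_of_swap (H : SimpleGraph V) (x : ℝ) {p₁ p₂ p₃ p₄ : V}
    (h : pathKernel H x p₂ p₄ * pathKernel H x p₁ p₃ ≤ pathKernel H x p₂ p₁ * pathKernel H x p₄ p₃) :
    pathKernel H x p₁ p₃ * pathKernel H x p₂ p₄ ≤ pathKernel H x p₁ p₂ * pathKernel H x p₃ p₄ :=
  (tp2_iff_swap12_34 H x p₁ p₂ p₃ p₄).2 h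

/-- Relabelling `(13)(24)`: the TP₂ instance `(p₃,p₄,p₁,p₂)` is the instance `(p₁,p₂,p₃,p₄)`. [folklore] -/
theorem tp2_of_rotate (H : SimpleGraph V) (x : ℝ) {p₁ p₂ p₃ p₄ : V}
    (h : pathKernel H x p₃ p₁ * pathKernel H x p₄ p₂ ≤ pathKernel H x p₃ p₄ * pathKernel H x p₁ p₂) :
    pathKernel H x p₁ p₃ * pathKernel H x p₂ p₄ ≤ pathKernel H x p₁ p₂ * pathKernel H x p₃ p₄ := by
  rw [pathKernel_comm H x p₃ p₁, pathKernel_comm H x p₄ p₂, mul_comm (pathKernel H x p₃ p₄)] at h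
  exact h

/-- Relabelling `(14)(23)`: the TP₂ instance `(p₄,p₃,p₂,p₁)` is the instance `(p₁,p₂,p₃,p₄)`. [folklore] -/
theorem tp2_of_reflect (H : SimpleGraph V) (x : ℝ) {p₁ p₂ p₃ p₄ : V}
    (h : pathKernel H x p₄ p₂ * pathKernel H x p₃ p₁ ≤ pathKernel H x p₄ p₃ * pathKernel H x p₂ p₁) :
    pathKernel H x p₁ p₃ * pathKernel H x p₂ p₄ ≤ pathKernel H x p₁ p₂ * pathKernel H x p₃ p₄ := by
  rw [pathKernel_comm H x p₄ p₂, pathKernel_comm H x p₃ p₁, pathKernel_comm H x p₄ p₃,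
    pathKernel_comm H x p₂ p₁, mul_comm (pathKernel H x p₂ p₄), mul_comm (pathKernel H x p₃ p₄)] at h
  exact h

/-- `Interlaced` under `(14)(23)`. [folklore] -/
theorem Interlaced.reflect {p₁ p₂ p₃ p₄ : V} (h : Interlaced H p₁ p₂ p₃ p₄) : Interlaced H p₄ p₃ p₂ p₁ :=
  h.swap.reverse_left.reverse_right

end Summit.CriticalPhenomena.SAWScalingLimit.Theorems.BoundaryTP2
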